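import Literature.Probability.RandomPlanarGeometry.RectangleConformalMap
import Literature.Analysis.Complex.SchwarzReflection
import Literature.Analysis.Complex.SlitHalfStripPoisson
import HarnessLib

/-!
# Stub H1 of the hardness certificate for `BoundaryDefectGaussianR`: a conformal map of the
# square onto the upper half-plane, holomorphic across the bottom side

Crux `Summit.CriticalPhenomena.CardyFormulaZ2.Theses.CardyBoundaryCoulombGas.BoundaryDefectGaussianR`
(stmt-CriticalPhenomena-14132), line `rainbow-monomials-in-excursion-kernels`, registered sub-goal
`h19_squareConformalMap`.

We produce `w : ℂ → ℂ` and an open `U ⊇ (-1,1)² ∪ ((-1,1) × {-1})` with `w` holomorphic on `U`,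
`w : (-1,1)² → ℍ = {0 < im}` bijective and `x ↦ re w(x - i)` strictly increasing on `(-1,1)`.

Construction. Let `Φ = rectPhi 1 1` be the boundary correspondence of the symmetric Riemann map
`g = rectMap 1 1` of the square (`RectangleConformalMap.lean`) and `q(ξ) = (1+ξ)/(1-ξ)` the Cayley
variable (`Literature.Analysis.Complex.cayleyQ`, disc → right half-plane), so that
`T ξ = i q(ξ)` maps the disc onto `ℍ`. Put `f u = T (Φ (u - i))` (the square shifted up by `i`, so
that its bottom side lies on `ℝ`): `f` is continuous on `U₀ ∩ {im ≥ 0}`, holomorphic on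
`U₀ ∩ {im > 0}` and real on `U₀ ∩ ℝ` for the box `U₀ = (-1,1) × (-2,2)` (there `Φ(u - i) ≠ 1 = Φ(1)`
by injectivity of `Φ`, and `|Φ| = 1` on the frontier). By the Schwarz reflection principle
(`Complex.differentiableOn_schwarzReflection`) the reflected function `F` is holomorphic on `U₀`, and
`w z = F (z + i)` is holomorphic on `U = (-1,1) × (-3,1)`, equal to `T ∘ g` on the square. On the
bottom side, `Φ(x - i) = conj Φ(x + i) = e^{-it}` with `t = topArg x` strictly decreasing in `x`
(`strictAntiOn_topArg`), and `re w(x - i) = im q(e^{it}) = cot(t/2)`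
(`Literature.Analysis.Complex.bdrySigma_eq_cotHalf`), strictly decreasing in `t ∈ (0, 2π)`
(`strictAntiOn_cotHalf`); hence `x ↦ re w(x - i)` is strictly increasing.

References: L. V. Ahlfors, *Complex Analysis*, 3rd ed. (1979), Ch. 6 §1.1 (Riemann map), Ch. 4 §6.5
(reflection principle); Ch. Pommerenke, *Boundary Behaviour of Conformal Maps* (1992), Thm. 2.6.
-/

noncomputable section

open Set Filter Topology Complex Metric
open Literature.Probability.RandomPlanarGeometry Literature.Analysis.Complex
open scoped Real ComplexConjugate

namespace Summit.CriticalPhenomena.CardyFormulaZ2.Cruxes.BoundaryDefectGaussianR.RainbowMonomialsInExcursionKernels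

/-- The boundary correspondence `Φ` of the square `(-1,1)²`. -/
local notation3 "Φ₁" => Literature.Probability.RandomPlanarGeometry.rectPhi (1 : ℝ) 1 one_pos one_pos

/-- The Riemann map `g` of the square `(-1,1)²`. -/
local notation3 "g₁" => Literature.Probability.RandomPlanarGeometry.rectMap (1 : ℝ) 1 one_pos one_pos

/-- The shifted map `f u = i q(Φ(u - i))`. -/
local notation3 "sqf" =>
  fun u : ℂ ↦ Complex.I * Literature.Analysis.Complex.cayleyQ (Φ₁ (u - Complex.I))

/-! ### The Cayley map `ξ ↦ i (1+ξ)/(1-ξ)` of the disc onto the upper half-plane -/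

/-- `i q` maps the unit disc into the upper half-plane (`im (i q) = re q > 0`). [folklore] -/
theorem sqmap_cayley_mapsTo :
    MapsTo (fun ξ : ℂ ↦ I * cayleyQ ξ) (ball 0 1) {z : ℂ | 0 < z.im} := by
  intro ξ hξ
  rw [mem_ball_zero_iff] at hξ
  simp only [mem_setOf_eq, I_mul_im]
  exact re_cayleyQ_pos hξ

/-- `q` commutes with complex conjugation. [folklore] -/
theorem sqmap_cayleyQ_conj (ξ : ℂ) : cayleyQ (conj ξ) = conj (cayleyQ ξ) := by
  simp only [cayleyQ, map_div₀, map_add, map_sub, map_one]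

/-- Inverting the Cayley variable: `q ((p-1)/(p+1)) = p` for `p ≠ -1`. [folklore] -/
theorem sqmap_cayleyQ_div {p : ℂ} (hp : p + 1 ≠ 0) : cayleyQ ((p - 1) / (p + 1)) = p := by
  have h1 : 1 + (p - 1) / (p + 1) = 2 * p / (p + 1) := by field_simp; ring
  have h2 : 1 - (p - 1) / (p + 1) = 2 / (p + 1) := by field_simp; ring
  simp only [cayleyQ]
  rw [h1, h2, div_div_div_cancel_right₀ hp, mul_div_cancel_left₀ p two_ne_zero]

/-- The inverse `z ↦ (-iz - 1)/(-iz + 1)` maps the upper half-plane into the unit disc. [folklore] -/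
theorem sqmap_cayleyInv_mapsTo :
    MapsTo (fun z : ℂ ↦ (-I * z - 1) / (-I * z + 1)) {z : ℂ | 0 < z.im} (ball 0 1) := by
  intro z hz
  simp only [mem_setOf_eq] at hz
  have hre : (-I * z).re = z.im := by simp
  have him : (-I * z).im = -z.re := by simp
  have hne : -I * z + 1 ≠ 0 := by
    intro h
    have := congrArg Complex.re h
    rw [add_re, hre, one_re, zero_re] at this
    linarith
  rw [mem_ball_zero_iff, norm_div, div_lt_one (norm_pos_iff.2 hne),
    ← sq_lt_sq₀ (norm_nonneg _) (norm_nonneg _), Complex.sq_norm, Complex.sq_norm]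
  simp only [normSq_apply, sub_re, add_re, one_re, sub_im, add_im, one_im, hre, him]
  nlinarith

/-- `i q((-iz-1)/(-iz+1)) = z` on the upper half-plane. [folklore] -/
theorem sqmap_cayley_rightInv {z : ℂ} (hz : 0 < z.im) :
    I * cayleyQ ((-I * z - 1) / (-I * z + 1)) = z := by
  have hne : -I * z + 1 ≠ 0 := by
    intro h
    have := congrArg Complex.re h
    simp at this
    linarith
  rw [sqmap_cayleyQ_div hne, ← mul_assoc, mul_neg, I_mul_I, neg_neg, one_mul]

/-- `(-i(i q ξ) - 1)/(-i (i q ξ) + 1) = ξ` for `ξ ≠ 1`. [folklore] -/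
theorem sqmap_cayley_leftInv {ξ : ℂ} (hξ : ξ ≠ 1) :
    (-I * (I * cayleyQ ξ) - 1) / (-I * (I * cayleyQ ξ) + 1) = ξ := by
  have h : -I * (I * cayleyQ ξ) = cayleyQ ξ := by
    rw [← mul_assoc, neg_mul, I_mul_I, neg_neg, one_mul]
  rw [h]
  exact (eq_div_of_cayleyQ hξ).symm

/-- **`ξ ↦ i (1+ξ)/(1-ξ)` is a bijection of the unit disc onto the upper half-plane.** [folklore] -/
theorem sqmap_cayley_bijOn : BijOn (fun ξ : ℂ ↦ I * cayleyQ ξ) (ball 0 1) {z : ℂ | 0 < z.im} := by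
  refine InvOn.bijOn (f' := fun z ↦ (-I * z - 1) / (-I * z + 1)) ⟨?_, ?_⟩ sqmap_cayley_mapsTo
    sqmap_cayleyInv_mapsTo
  · intro ξ hξ
    have hξ1 : ξ ≠ 1 := by rintro rfl; simp at hξ
    exact sqmap_cayley_leftInv hξ1
  · intro z hz
    exact sqmap_cayley_rightInv hz

/-! ### The square `(-1,1)²`, its boundary correspondence and the shifted map `f` -/

/-- A point of the closed square with `re p < 1` is not mapped to `1 = Φ(1)`. [folklore] -/
theorem sqmap_rectPhi_ne_one {p : ℂ} (hp : p ∈ closure (symRect 1 1)) (hre : p.re < 1) :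
    Φ₁ p ≠ 1 := by
  intro h
  have h1 : ((1 : ℝ) : ℂ) ∈ closure (symRect 1 1) :=
    frontier_subset_closure (ofReal_mem_frontier_symRect one_pos one_pos)
  have h2 : Φ₁ ((1 : ℝ) : ℂ) = 1 := rectPhi_ofReal one_pos one_pos
  have h3 : p = ((1 : ℝ) : ℂ) := injOn_rectPhi one_pos one_pos hp h1 (h.trans h2.symm)
  rw [h3, ofReal_re] at hre
  exact lt_irrefl _ hre

/-- `u ↦ u - i` maps the closed upper half of the box `(-1,1) × (-2,2)` into the closed square. [folklore] -/
theorem sqmap_sub_I_mem_closure {u : ℂ}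
    (hu : u ∈ (Ioo (-1 : ℝ) 1 ×ℂ Ioo (-2 : ℝ) 2) ∩ {u : ℂ | 0 ≤ u.im}) :
    u - I ∈ closure (symRect 1 1) := by
  obtain ⟨⟨h1, h2⟩, h3, h4⟩ := mem_reProdIm.1 hu.1
  have h5 : 0 ≤ u.im := hu.2
  rw [mem_closure_symRect one_pos one_pos]
  simp only [sub_re, I_re, sub_zero, sub_im, I_im]
  exact ⟨⟨h1.le, h2.le⟩, by linarith, by linarith⟩

/-- `u ↦ u - i` maps the open upper half of the box `(-1,1) × (-2,2)` into the open square. [folklore] -/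
theorem sqmap_sub_I_mem {u : ℂ}
    (hu : u ∈ (Ioo (-1 : ℝ) 1 ×ℂ Ioo (-2 : ℝ) 2) ∩ {u : ℂ | 0 < u.im}) :
    u - I ∈ symRect 1 1 := by
  obtain ⟨⟨h1, h2⟩, h3, h4⟩ := mem_reProdIm.1 hu.1
  have h5 : 0 < u.im := hu.2
  rw [mem_symRect]
  simp only [sub_re, I_re, sub_zero, sub_im, I_im]
  exact ⟨⟨h1, h2⟩, by linarith, by linarith⟩

/-- `f u = i q(Φ(u - i))` is continuous on the closed upper half of the box. [folklore] -/
theorem sqmap_f_continuousOn :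
    ContinuousOn sqf ((Ioo (-1 : ℝ) 1 ×ℂ Ioo (-2 : ℝ) 2) ∩ {u : ℂ | 0 ≤ u.im}) := by
  have hmaps : MapsTo (fun u : ℂ ↦ u - I) ((Ioo (-1 : ℝ) 1 ×ℂ Ioo (-2 : ℝ) 2) ∩ {u : ℂ | 0 ≤ u.im})
      (closure (symRect 1 1)) := fun u hu ↦ sqmap_sub_I_mem_closure hu
  have hΦ : ContinuousOn (fun u : ℂ ↦ Φ₁ (u - I))
      ((Ioo (-1 : ℝ) 1 ×ℂ Ioo (-2 : ℝ) 2) ∩ {u : ℂ | 0 ≤ u.im}) :=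
    (continuousOn_rectPhi one_pos one_pos).comp (continuous_sub_right I).continuousOn hmaps
  intro u hu
  have hne : Φ₁ (u - I) ≠ 1 :=
    sqmap_rectPhi_ne_one (hmaps hu) (by simpa using (mem_reProdIm.1 hu.1).1.2)
  have hT : ContinuousAt (fun ξ : ℂ ↦ I * cayleyQ ξ) (Φ₁ (u - I)) :=
    ((differentiableAt_cayleyQ hne).const_mul I).continuousAt
  exact ContinuousAt.comp_continuousWithinAt (g := fun ξ : ℂ ↦ I * cayleyQ ξ)
    (f := fun u : ℂ ↦ Φ₁ (u - I)) (x := u) hT (hΦ u hu)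

/-- `f` is holomorphic on the open upper half of the box (there `Φ = g`). [folklore] -/
theorem sqmap_f_differentiableOn :
    DifferentiableOn ℂ sqf ((Ioo (-1 : ℝ) 1 ×ℂ Ioo (-2 : ℝ) 2) ∩ {u : ℂ | 0 < u.im}) := by
  have hmaps : MapsTo (fun u : ℂ ↦ u - I) ((Ioo (-1 : ℝ) 1 ×ℂ Ioo (-2 : ℝ) 2) ∩ {u : ℂ | 0 < u.im})
      (symRect 1 1) := fun u hu ↦ sqmap_sub_I_mem hu
  have hg : DifferentiableOn ℂ (fun u : ℂ ↦ g₁ (u - I))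
      ((Ioo (-1 : ℝ) 1 ×ℂ Ioo (-2 : ℝ) 2) ∩ {u : ℂ | 0 < u.im}) :=
    (rectMap (1 : ℝ) 1 one_pos one_pos).differentiableOn_coe.comp
      (differentiableOn_id.sub_const I) hmaps
  have h0 : DifferentiableOn ℂ (fun u : ℂ ↦ I * cayleyQ (g₁ (u - I)))
      ((Ioo (-1 : ℝ) 1 ×ℂ Ioo (-2 : ℝ) 2) ∩ {u : ℂ | 0 < u.im}) := by
    intro u hu
    have hball : g₁ (u - I) ∈ ball (0 : ℂ) 1 := (rectMap (1 : ℝ) 1 one_pos one_pos).mapsTo (hmaps hu)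
    have hne : g₁ (u - I) ≠ 1 := by
      intro h
      rw [h] at hball
      simp at hball
    exact DifferentiableAt.comp_differentiableWithinAt (g := fun ξ : ℂ ↦ I * cayleyQ ξ)
      (f := fun u : ℂ ↦ g₁ (u - I)) u ((differentiableAt_cayleyQ hne).const_mul I) (hg u hu)
  refine h0.congr fun u hu ↦ ?_
  simp only [rectPhi_eq one_pos one_pos (hmaps hu)]

/-- `f` is real on the real points of the box (`|Φ| = 1` on the bottom side, `q` is purely
imaginary on the circle). [folklore] -/
theorem sqmap_f_real :
    ∀ u ∈ Ioo (-1 : ℝ) 1 ×ℂ Ioo (-2 : ℝ) 2, u.im = 0 →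
      conj (I * cayleyQ (Φ₁ (u - I))) = I * cayleyQ (Φ₁ (u - I)) := by
  intro u hu h0
  obtain ⟨⟨h1, h2⟩, -⟩ := mem_reProdIm.1 hu
  have hfr : u - I ∈ frontier (symRect 1 1) := by
    rw [mem_frontier_symRect one_pos one_pos]
    left
    simp only [sub_re, I_re, sub_zero, sub_im, I_im]
    exact ⟨⟨h1.le, h2.le⟩, Or.inl (by rw [h0]; norm_num)⟩
  have hne : Φ₁ (u - I) ≠ 1 := sqmap_rectPhi_ne_one (frontier_subset_closure hfr) (by simpa using h2)
  have him : (I * cayleyQ (Φ₁ (u - I))).im = 0 := by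
    rw [I_mul_im]
    exact re_cayleyQ_eq_zero (norm_rectPhi one_pos one_pos hfr) hne
  exact conj_eq_iff_im.2 him

/-- **Schwarz reflection**: the reflected function `F` of `f` is holomorphic on the whole box
`(-1,1) × (-2,2)`. [folklore] -/
theorem sqmap_F_differentiableOn :
    DifferentiableOn ℂ (schwarzReflection sqf) (Ioo (-1 : ℝ) 1 ×ℂ Ioo (-2 : ℝ) 2) := by
  refine differentiableOn_schwarzReflection (isOpen_Ioo.reProdIm isOpen_Ioo) ?_
    sqmap_f_continuousOn sqmap_f_differentiableOn sqmap_f_real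
  intro z hz
  obtain ⟨h1, h2, h3⟩ := mem_reProdIm.1 hz
  refine mem_reProdIm.2 ⟨by simpa using h1, ?_⟩
  simp only [conj_im]
  exact ⟨by linarith, by linarith⟩

/-- `w z = F (z + i)` is holomorphic on `U = (-1,1) × (-3,1)`. [folklore] -/
theorem sqmap_w_differentiableOn :
    DifferentiableOn ℂ (fun z : ℂ ↦ schwarzReflection sqf (z + I)) (Ioo (-1 : ℝ) 1 ×ℂ Ioo (-3 : ℝ) 1) := by
  have hmaps : MapsTo (fun z : ℂ ↦ z + I) (Ioo (-1 : ℝ) 1 ×ℂ Ioo (-3 : ℝ) 1)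
      (Ioo (-1 : ℝ) 1 ×ℂ Ioo (-2 : ℝ) 2) := by
    intro z hz
    obtain ⟨h1, h2, h3⟩ := mem_reProdIm.1 hz
    refine mem_reProdIm.2 ⟨by simpa using h1, ?_⟩
    simp only [add_im, I_im]
    exact ⟨by linarith, by linarith⟩
  exact sqmap_F_differentiableOn.comp (differentiableOn_id.add_const I) hmaps

/-- On the open square `w = i q ∘ g`. [folklore] -/
theorem sqmap_w_eq {z : ℂ} (hz : z ∈ symRect 1 1) :
    schwarzReflection sqf (z + I) = I * cayleyQ (g₁ z) := by
  have him : 0 ≤ (z + I).im := by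
    have := (mem_symRect.1 hz).2.1
    simp only [add_im, I_im]
    linarith
  rw [schwarzReflection_of_nonneg him]
  show I * cayleyQ (Φ₁ (z + I - I)) = _
  rw [add_sub_cancel_right, rectPhi_eq one_pos one_pos hz]

/-- **`w` is a bijection of the open square onto the upper half-plane.** [folklore] -/
theorem sqmap_w_bijOn :
    BijOn (fun z : ℂ ↦ schwarzReflection sqf (z + I)) (symRect 1 1) {z : ℂ | 0 < z.im} :=
  (sqmap_cayley_bijOn.comp (rectMap (1 : ℝ) 1 one_pos one_pos).bijOn).congr
    fun _ hz ↦ (sqmap_w_eq hz).symm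

/-- **The boundary values on the bottom side**: `re w(x - i) = cot (topArg x / 2)` for
`-1 < x < 1` (`Φ(x - i) = conj Φ(x + i) = e^{-i topArg x}`). [folklore] -/
theorem sqmap_w_bottom {x : ℝ} (hx : x ∈ Ioo (-1 : ℝ) 1) :
    (schwarzReflection sqf (⟨x, -1⟩ + I)).re = cotHalf (topArg 1 1 one_pos one_pos x) := by
  have him : ((⟨x, -1⟩ : ℂ) + I).im = 0 := by simp
  rw [schwarzReflection_of_nonneg him.ge]
  show (I * cayleyQ (Φ₁ (⟨x, -1⟩ + I - I))).re = _
  rw [add_sub_cancel_right]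
  have hcl : (⟨x, 1⟩ : ℂ) ∈ closure (symRect 1 1) :=
    frontier_subset_closure (top_mem_frontier one_pos one_pos (Ioo_subset_Icc_self hx))
  have hconj : (⟨x, -1⟩ : ℂ) = conj ⟨x, 1⟩ := Complex.ext (by simp) (by simp)
  have hθ := rectTheta_mem (a := (1 : ℝ)) (b := 1) one_pos one_pos
  obtain ⟨ht, hexp⟩ := topArg_mem one_pos one_pos hx
  have ht' : topArg 1 1 one_pos one_pos x ∈ Ioo 0 (2 * π) :=
    ⟨by linarith [ht.1, hθ.1], by linarith [ht.2, hθ.1, Real.pi_pos]⟩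
  rw [hconj, rectPhi_conj one_pos one_pos hcl, hexp, sqmap_cayleyQ_conj, I_mul_re, conj_im, neg_neg,
    ← bdrySigma_eq_cotHalf ht']
  simp only [bdrySigma, circleMap, ofReal_one, one_mul, zero_add]

/-- **`x ↦ re w(x - i)` is strictly increasing on `(-1, 1)`** (`topArg` is strictly decreasing and
so is `cot(·/2)` on `(0, 2π)`). [folklore] -/
theorem sqmap_w_strictMonoOn :
    StrictMonoOn (fun x : ℝ ↦ (schwarzReflection sqf (⟨x, -1⟩ + I)).re) (Ioo (-1 : ℝ) 1) := by
  have hθ := rectTheta_mem (a := (1 : ℝ)) (b := 1) one_pos one_pos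
  have hmaps : MapsTo (topArg 1 1 one_pos one_pos) (Ioo (-1 : ℝ) 1) (Ioo 0 (2 * π)) := by
    intro x hx
    have ht := (topArg_mem one_pos one_pos hx).1
    exact ⟨by linarith [ht.1, hθ.1], by linarith [ht.2, hθ.1, Real.pi_pos]⟩
  have hanti : StrictAntiOn (topArg 1 1 one_pos one_pos) (Ioo (-1 : ℝ) 1) :=
    (strictAntiOn_topArg one_pos one_pos).mono Ioo_subset_Icc_self
  have h := strictAntiOn_cotHalf.comp hanti hmaps
  intro a ha b hb hab
  simp only [sqmap_w_bottom ha, sqmap_w_bottom hb]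
  exact h ha hb hab

/-- **Stub H1.** The open square `(-1,1)²` admits a holomorphic bijection onto the upper half-plane which
extends holomorphically to a neighbourhood of the square together with its open bottom side, with real part
strictly increasing along the bottom side (Riemann map of the rectangle `rectMap`, a Cayley transform, and
the Schwarz reflection principle). [folklore] -/
theorem h19_squareConformalMap : ∃ (w : ℂ → ℂ) (U : Set ℂ), IsOpen U ∧
    Literature.Probability.RandomPlanarGeometry.symRect 1 1 ⊆ U ∧
    (∀ x : ℝ, -1 < x → x < 1 → (⟨x, -1⟩ : ℂ) ∈ U) ∧ DifferentiableOn ℂ w U ∧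
    Set.BijOn w (Literature.Probability.RandomPlanarGeometry.symRect 1 1) {z : ℂ | 0 < z.im} ∧
    StrictMonoOn (fun x : ℝ ↦ (w ⟨x, -1⟩).re) (Set.Ioo (-1) 1) := by
  refine ⟨fun z : ℂ ↦ schwarzReflection sqf (z + I), Ioo (-1 : ℝ) 1 ×ℂ Ioo (-3 : ℝ) 1,
    isOpen_Ioo.reProdIm isOpen_Ioo, ?_, ?_, sqmap_w_differentiableOn, sqmap_w_bijOn,
    sqmap_w_strictMonoOn⟩
  · intro z hz
    rw [mem_symRect] at hz
    exact mem_reProdIm.2 ⟨hz.1, by linarith [hz.2.1], hz.2.2⟩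
  · intro x h1 h2
    exact mem_reProdIm.2 ⟨⟨h1, h2⟩, by norm_num, by norm_num⟩

end Summit.CriticalPhenomena.CardyFormulaZ2.Cruxes.BoundaryDefectGaussianR.RainbowMonomialsInExcursionKernels
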